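import Mathlib
import HarnessLib
import HarnessLib.Audit
import Literature.InformationTheory.QuantumCodes.BivariateBicycleCodes
import Summits.Ventures.QEC.Census.BB.Claims

/-!
Route: BB288DistanceCertificate

# Route BB288DistanceCertificate — the [[288,12,18]] bivariate-bicycle code has distance exactly 18,
by certificate

It suffices to show X = (no Z-type logical operator of the bivariate-bicycle code QC(x³+y²+y⁷,
y³+x+x²) on ℤ₁₂ × ℤ₁₂ = `BB.bb288` has
Hamming weight ≤ 17) ∧ (some Z-type logical operator has weight exactly 18) ∧ (k = n − rk H^X − rk
H^Z = 12). X is the content of a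
DISTANCE CERTIFICATE for the printed row [[288,12,18]] of Bravyi–Cross–Gambetta–Maslov–Rall–Yoder
(Nature 627 (2024) Table 1; distance
there "computed by the mixed integer programming approach", no certificate in print): lower bound =
an exhaustive enumeration / UNSAT
certificate re-checked in the kernel, upper bound = one explicit codeword, dimension = a rank
certificate. The route is the LADDER-QEC
rung-Q2 route of cell pub/qec (venture ruling D-0059/D-0061/D-0092): its deciding theorem concludes
the registered CLAIM leaf
`Summit.Ventures.QEC.BB.BB288_12_18_claim` (`HasParams BB.bb288 144 12 12`), never a summit
Statement (Ventures/QEC has none). No idea card.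
Lean: `(∀ v : Literature.InformationTheory.QuantumCodes.BB.Mono 12 12 ⊕
Literature.InformationTheory.QuantumCodes.BB.Mono 12 12 → ZMod 2, Matrix.mulVec
(Literature.InformationTheory.QuantumCodes.BB.bb288).css.HX v = 0 → v ∉
(Literature.InformationTheory.QuantumCodes.BB.bb288).css.rowSpZ → 18 ≤ hammingNorm v) ∧ (∃ v :
Literature.InformationTheory.QuantumCodes.BB.Mono 12 12 ⊕
Literature.InformationTheory.QuantumCodes.BB.Mono 12 12 → ZMod 2, Matrix.mulVec
(Literature.InformationTheory.QuantumCodes.BB.bb288).css.HX v = 0 ∧ v ∉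
(Literature.InformationTheory.QuantumCodes.BB.bb288).css.rowSpZ ∧ hammingNorm v = 18) ∧
(Literature.InformationTheory.QuantumCodes.BB.bb288).k = 12`

## Assembly
Pure logic over three tree lemmas: from `WeightEighteenZLogical` take v; `CSSCode.dZ_eq_of_witness
hv hv' hwt NoZLogicalBelowEighteen : BB.bb288.css.dZ = 12`;
`Summit.Ventures.QEC.BB.numQubits_claims.2.2.2.2 : BB.numQubits 12 12 = 288` (counting, proved);
`TwelveLogicalQubits288 : BB.bb288.k = 12`; then
`Summit.Ventures.QEC.BB.hasParams_of_dZ` (d = d^Z, Lemma 1, proved) gives `HasParams BB.bb288 144 12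
12 = BB288_12_18_claim`. The deciding theorem
`closes` in glue.lean is exactly this, routed through `Assembly` and `Target` so both are in its
cone (lean check rc 0, 0 sorries).

CLOSES_TARGET: closes rung Q2 of Ventures/QEC: Summit.Ventures.QEC.BB.BB288_12_18_claim (D-0061; not the summit Statement) — the deciding theorem of this route concludes that registered leaf (Ventures/QEC: no summit Statement) (class rung: servable and labelled, never counted as concluding the summit Statement).

Rationale: WHY THIS LINE. The mechanism is the certificate shape of `CSSCode.dZ_eq_of_witness` (tree,
CSS.lean): an explicit logical of weight d plus the universally
checked statement "every logical has weight ≥ d" give d^Z = d, and for every QC(A, B) d = d^Z = d^X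
(Lemma 1 of [BravyiEtAl2024],
arXiv:2308.07915 §4, proved in the tree as `BB.Code.d_eq_dZ`), so one side suffices (cell CERT-REQS
C8). The lower bound is the only
expensive conjunct. Cell state (FINDINGS CR-5): certB = search-2 cube-and-conquer CNF→CaDiCaL→LRAT,
encoding enc-v2 (XOR-direct + sequential-counter
cardinality + translation-symmetry pins under the PROVED orbit lemma `TwoBlockOrbitReduction`
p461461 + parity W = 16 under `BB.even_d_instances` p467820),
sha16 216d9d94167485d2, 1 377 leaves all UNSAT with LRAT proofs VERIFIED in-job (108 GB, unshipped;
10.5 core-h), ref-1 SIGNED 2026-08-26T21:13:47Z at tier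
COMPUTED-B with its assumptions DISCHARGED by tree theorems; certA = search-1 Brouwer–Zimmermann
with automorphisms (bz_aut, j257847/j257849, cap 100 core-h)
PENDING; weight-18 Z/X witnesses in hand; parity excludes 17. HONEST TIER STATEMENT: NO kernel path
for the 288 lower bound is sized tonight (kernel-B Σ hints
far beyond branch-3 limits; BZ enumeration ≈ 4·10⁹ visits/side) — the lower-bound item of this route
is expected to close at COMPUTED / CHECKED tiers only
for now, and the route exists so that the witness, k and any future kernel certificate have typed
targets. Imported from coding theory: Brouwer–Zimmermann /
information-set enumeration and DRAT/LRAT proof logging for the UNSAT side. What the line does that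
print does not: Nature ED Table 1 reports a MIP optimum
with no checkable artefact; Lean-QEC (arXiv:2605.16523 v1; repo main @ e0b90148) STATES BB288 with
sorry ×4 («a major goal» in their notes) ⇒ [[288,12,18]]
is OPEN in Lean (lean_prior «stated:sorry», director-qec 2026-08-26T22:04:58Z); any priority wording
is released only through the cell's lit-3
PRIOR-ART-LeanQEC.md table and only at the tier that lands.

RANKED CRUXES. #0 Target (target) — the printed row — QC(x³+y²+y⁷, y³+x+x²) on ℤ₁₂ × ℤ₁₂ has
parameters [[288, 12, 18]] (n = 288 data qubits, k = 12, distance EXACTLY 18). (why it might fail: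
only if the printed MIP distance or dimension is wrong — one signed cell kernel (cube-and-conquer
CNF/LRAT, certB) gives exactly 18, certA bz_aut pending; and, as a Lean item, the lower bound has no
sized kernel path at n = 288 (the route may stay open on it).) [BravyiEtAl2024, arXiv:2308.07915]
#2 NoZLogicalBelowEighteen (crux) — LOWER BOUND — every v with H^X v = 0 and v ∉ rowspace(H^Z) (a
Z-type logical operator of BB.bb288) has Hamming weight ≥ 18; equivalently no Z-logical of weight ≤
17 exists. Evidence in the cell: certB 216d9d94167485d2 (enc-v2 cube-and-conquer LRAT, 1 377 leaves,
ref-1 signed COMPUTED-B, assumptions discharged by p461461/p467820/p459385); certA bz_aut pending.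
NO kernel replay is sized for n = 288 tonight: this item is expected to stay OPEN (COMPUTED evidence
only) until a kernel-feasible certificate exists (compressed bz_aut / in-kernel MITM / engineered
evaluator — the 144 probes α/β/γ of director-qec 22:52:31Z decide the method family first).
[difficulty: M] (why it might fail: false iff a Z-logical of weight ≤ 17 exists (printed d = 18 by
MIP; certB says none; certA pending); AS A LEAN ITEM it may simply stay open: no kernel path is
sized at n = 288 (enumeration ≈ 4·10⁹ visits/side, LRAT Σ hints ≫ 15 M).) [BravyiEtAl2024,
arXiv:2308.07915, Vardy1997, KapshikarKundu2023]
#3 WeightEighteenZLogical (crux) — UPPER WITNESS — there is an explicit v with H^X v = 0, v ∉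
rowspace(H^Z) and |v| = 18 (a weight-18 Z-type logical operator); the certificates list one (certB
witness words Z/X, RESULTS-BB288.md), non-membership in rowspace(H^Z) is a rank / syndrome check
decidable on the literal matrices. [difficulty: S] (why it might fail: false iff d ≥ 19 (every
weight-18 kernel word of H^X is a Z-stabiliser); the listed witness could be mis-transcribed or
secretly in rowspace(H^Z) — the non-membership proof is the delicate part in Lean.) [BravyiEtAl2024,
arXiv:2308.07915]
#9 TwelveLogicalQubits288 (support) — DIMENSION — k(BB.bb288) = 288 − rk H^X − rk H^Z = 12 (rk H^X =
rk H^Z = 138 over 𝔽₂), by a rank certificate (type-02's Census/RankCert.lean p462257; BB288Rank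
staged by type-02 g2, chunked `RankCert.check`) transported with `BB.Code.cssFlat_k`; equivalently k
= 2·dim(ker A ∩ ker B) (Lemma 1). [difficulty: provable-now] [BravyiEtAl2024, arXiv:2308.07915,
CalderbankShor1996]

TWO-LAYER PLAN. Foreseen split of NoZLogicalBelowEighteen once a kernel-feasible certificate family
exists (decided on the 144 probes α compressed bz_aut / β in-kernel MITM / γ pinned one-side LRAT,
director-qec 22:52:31Z): NoZLogicalBelowEighteen ⇐ (checker soundness on the flat code, type-10
CertCheckBZ/CertCheckBZAut) → (the data facts per block, chunk files) → NoZLogicalBelowEighteen via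
`BB.Code.dZ_eq_of_flat` / `BB.d_eq_of_bzAut_translateFlat_even` p470223; k ≤ 3 children, depth 1.
Nothing filed now.

KILL CRITERIA. A kernel-checked Z-logical (or X-logical, d^X = d^Z) of weight ≤ 17 refutes
NoZLogicalBelowEighteen and the CLAIM itself (route closes refuted:NoZLogicalBelowEighteen and the
census row becomes a DISCREPANCY finding against Nature 627 Table 1); a proof that rk H^X ≠ 138
refutes TwelveLogicalQubits288 likewise. TIER HONESTY (director-qec 2026-08-26T22:52:31Z R3): the
lower-bound item will close at COMPUTED / CHECKED tiers only for now — i.e. NOT close as a Lean item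
tonight; the route is not failing while that item is open with signed COMPUTED evidence, it is
waiting for a kernel-feasible certificate family (decided on the 144 probes). A proof of
`BB288_12_18_claim` landed by any other cell file moots the route — closed superseded with the
discharging theorem named.

NOT DECOMPOSED YET. The checker-soundness / data-fact split of the lower bound (Two-layer plan), the
X-side mirror statements (unnecessary: d^X = d^Z is a tree theorem), and the per-chunk leaf theorems
of the kernel replay — all are prover-side packaging below item level (attached with --supports
NoZLogicalBelowEighteen), never items.

CHEAPEST FALSIFIER. Run any distance tool on H^X = [A|B], H^Z = [Bᵀ|Aᵀ] of BB.bb288 and look for a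
logical of weight ≤ 17. Done inside the cell before filing: certB cube-and-conquer UNSAT at W = 16
with parity (no weight-17 logical possible: all Z-logicals even, p467820) — 1 377/1 377 leaves
UNSAT, LRAT-verified in job (search-2 j258732), 69/69 sampled leaves independently re-verified
(j259335), ref-1 own re-derivation (kit j260310) and signature 2026-08-26T21:13:47Z; weight-18
witnesses X/Z exhibited; BP+OSD corrects every error of weight ≤ 4 exhaustively (search-6; w = 5
layer not run) ⇒ d ≥ 9 independently; certA bz_aut (search-1 j257847/j257849) pending.

NUMBERS. n = 288 = 2·12·12; k = 12; d = d^X = d^Z = 18 (Nature 627 Table 1; kd²/n = 13.5); rk H^X =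
rk H^Z = 138; certB 216d9d94167485d2: 1 377 cubes (≤ 4 096 intended, merged), Σ solve 10.5 core-h,
largest leaf LRAT 300 MB, total LRAT 108 GB (unshipped; regenerable bit-for-bit under pinned CaDiCaL
2.1.3 sha 4891b58d…) ⇒ kernel-B replay NOT feasible; BZ enumeration ≈ 4·10⁹ visits/side with
automorphisms ⇒ kernel NOT feasible at measured 10³–10⁶ visits/s; the item map for files:
lower-bound evidence files `--supports <NoZLogicalBelowEighteen item>`, k by type-02 g2 (BB288Rank),
witness by decide (cheap, 288-bit vector).

DEFINITION REQUESTS. None: `BB.Code`, `BB.bb288`, `CSSCode.dZ/dX/k/rowSpZ`, `hammingNorm`,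
`HasParams`, the flat bridge `BB.Code.cssFlat` (+ `dZ_eq_of_flat`, `cssFlat_k`) and the checker
`Census/CertCheck.lean` are all in the tree. Cite fact wanted: none (BravyiEtAl2024 is in
references.bib; the claim decl carries the locators).

Novelty: Searches (2026-08-26): lit search "bivariate bicycle code distance" (6 local docs: arXiv:2308.07915,
2502.20189, 2510.06495, 2411.03302, 2605.14173, 2503.22071; 13 remote merged, OpenAlex/S2
rate-limited); lit galaxy search "bivariate bicycle|[[288,12,18]]|BB code distance" --star all
(panama 0, pdf 5 decoder papers, crabby 0); cell literature seats lit-3 (LIT-3-CONSTRUCTIONS.md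
v1.1: "how d was established in print" = MILP for all five BB rows, Nature ED Table 1 caption p0011)
and lit-1 (LIT-1-REGISTER.md: families with proved d vs exhaustive/LP vs upper-bound-only).
Nearest prior art found: BravyiEtAl2024 = arXiv:2308.07915 (Nature 627, 778) Table 1 / ED Table 1 —
the parameters by mixed-integer programming (their ref. 68), no certificate; arXiv:2502.20189 Table
I reprints the row; QDistRnd-style randomized upper bounds (Pryadko et al.) for related two-block
codes (lit-3 A2/A3).
Delta: typed targets + a COMPLETE certificate programme for QC(x³+y²+y⁷, y³+x+x²) on ℤ₁₂ × ℤ₁₂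
(`BB.bb288`): distance exactly 18 and k = 12 — witness and k at KERNEL-std (cheap), lower bound at
COMPUTED-B today (certB 216d9d94167485d2, ref-1 signed, assumptions discharged by tree theorems) and
at a kernel tier only when a feasible certificate family exists; print has solver (MIP) output only.
PRIOR ART OF RECORD (director-qec 22:04:58Z; FINDINGS PA-1/PA-2): Lean-QEC (Ehatamm–Lee–Wu–Tao,
arXiv:2605.16523 v1, May 2026; repo VerifiedQC/Lean-QEC main @ e0b90148) proves BB72/BB90 completely
(KERNEL-bv) a  [refs: 2308.07915, 2502.20189, 2605.16523, BravyiEtAl2024]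

Barriers (technique_class: certified-computation, enumeration, unsat-cert): - technique_class: certified-computation, enumeration, unsat-cert
- Literature.Barriers.Ventures: no catalogued barrier directory exists for Ventures (ls
lean/Literature/Barriers/ has none); the technique-class barrier is NP-hardness of minimum distance
—
`Literature.InformationTheory.QuantumCodes.MinimumDistanceHardness.Vardy1997_minimumDistance_isNPComplete`
and `KapshikarKundu2023_quantumMinimumDistance_isNPHard` (tree, named facts): they bound the
asymptotic cost of a uniform algorithm, not a fixed instance — n = 288, w ≤ 17 is a fixed finite
instance, enumerated with symmetry reduction / UNSAT-certified and kernel-replayed; the route does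
not claim a method that scales.
- Negatives index: empty for Ventures/QEC at filing (ledger negatives --problem Ventures consulted
by the cell's refuter seats; no refuted statement about BB codes).

sub-problem: QEC · status: draft · opened operator:999:2414619 2026-08-26T23:35:31Z · rev 0 · ledger route-Ventures-BB288DistanceCertificate
GENERATED by the gate from the ledger (D-0016/17). Provers cite these decls: `theorem foo : Summit.Ventures.QEC.Theses.BB288DistanceCertificate.<Decl> := …` in Summits/Ventures/QEC/Theorems/<Name>.lean.
-/

namespace Summit.Ventures.QEC.Theses.BB288DistanceCertificate

open scoped BigOperators Topology Manifold Classical MeasureTheory ProbabilityTheory Matrix InnerProductSpace ComplexConjugate ContinuousMap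
open Filter Set Function TopologicalSpace MeasureTheory

-- H21.Audit: Ventures rung route — no summit Statement decl; the expected conclusion is the closer leaf tagged below
attribute [summit_statement] _root_.Summit.Ventures.QEC.BB.BB288_12_18_claim

/-- item stmt-Ventures-19832 · target · rank 0 · closed · proved by Summit.Ventures.QEC.Census.BB288.target288_proof (prover) · by operator
why it might fail: only if the printed MIP distance or dimension is wrong — one signed cell kernel (cube-and-conquer CNF/LRAT, certB) gives exactly 18, certA bz_aut pending; and, as a Lean item, the lower bound has no sized kernel path at n = 288 (the route may stay open on it).
sources: BravyiEtAl2024, arXiv:2308.07915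
[target] the printed row — QC(x³+y²+y⁷, y³+x+x²) on ℤ₁₂ × ℤ₁₂ has parameters [[288, 12, 18]] (n =
288 data qubits, k = 12, distance EXACTLY 18). -/
@[route_item "route-Ventures-BB288DistanceCertificate"]
def Target : Prop :=
  Summit.Ventures.QEC.BB.BB288_12_18_claim

-- `Target` holds: proved by `Summit.Ventures.QEC.Census.BB288.target288_proof` (its module imports this route file, so no `_holds` link can be stated here).

/-- item stmt-Ventures-19833 · crux · rank 2 · closed · proved by Summit.Ventures.QEC.Census.BB288.noZLogicalBelowEighteen_proof (prover) · by operator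
why it might fail: false iff a Z-logical of weight ≤ 17 exists (printed d = 18 by MIP; certB says none; certA pending); AS A LEAN ITEM it may simply stay open: no kernel path is sized at n = 288 (enumeration ≈ 4·10⁹ visits/side, LRAT Σ hints ≫ 15 M).
sources: BravyiEtAl2024, arXiv:2308.07915, Vardy1997, KapshikarKundu2023
[crux] LOWER BOUND — every v with H^X v = 0 and v ∉ rowspace(H^Z) (a Z-type logical operator of
BB.bb288) has Hamming weight ≥ 18; equivalently no Z-logical of weight ≤ 17 exists. Evidence in the
cell: certB 216d9d94167485d2 (enc-v2 cube-and-conquer LRAT, 1 377 leaves, ref-1 signed COMPUTED-B,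
assumptions discharged by p461461/p467820/p459385); certA bz_aut pending. NO kernel replay is sized
for n = 288 tonight: this item is expected to stay OPEN (COMPUTED evidence only) until a
kernel-feasible certificate exists (compressed bz_aut / in-kernel MITM / engineered evaluator — the
144 probes α/β/γ of director-qec 22:52:31Z decide the method family first). [difficulty: M] -/
@[route_item "route-Ventures-BB288DistanceCertificate"]
def NoZLogicalBelowEighteen : Prop :=
  ∀ v : Literature.InformationTheory.QuantumCodes.BB.Mono 12 12 ⊕ Literature.InformationTheory.QuantumCodes.BB.Mono 12 12 → ZMod 2, Matrix.mulVec (Literature.InformationTheory.QuantumCodes.BB.bb288).css.HX v = 0 → v ∉ (Literature.InformationTheory.QuantumCodes.BB.bb288).css.rowSpZ → 18 ≤ hammingNorm v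

-- `NoZLogicalBelowEighteen` holds: proved by `Summit.Ventures.QEC.Census.BB288.noZLogicalBelowEighteen_proof` (its module imports this route file, so no `_holds` link can be stated here).

/-- item stmt-Ventures-19834 · crux · rank 3 · closed · proved by Summit.Ventures.QEC.Census.BB288.weightEighteenZLogical_proof (prover) · by operator
why it might fail: false iff d ≥ 19 (every weight-18 kernel word of H^X is a Z-stabiliser); the listed witness could be mis-transcribed or secretly in rowspace(H^Z) — the non-membership proof is the delicate part in Lean.
sources: BravyiEtAl2024, arXiv:2308.07915
[crux] UPPER WITNESS — there is an explicit v with H^X v = 0, v ∉ rowspace(H^Z) and |v| = 18 (a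
weight-18 Z-type logical operator); the certificates list one (certB witness words Z/X,
RESULTS-BB288.md), non-membership in rowspace(H^Z) is a rank / syndrome check decidable on the
literal matrices. [difficulty: S] -/
@[route_item "route-Ventures-BB288DistanceCertificate"]
def WeightEighteenZLogical : Prop :=
  ∃ v : Literature.InformationTheory.QuantumCodes.BB.Mono 12 12 ⊕ Literature.InformationTheory.QuantumCodes.BB.Mono 12 12 → ZMod 2, Matrix.mulVec (Literature.InformationTheory.QuantumCodes.BB.bb288).css.HX v = 0 ∧ v ∉ (Literature.InformationTheory.QuantumCodes.BB.bb288).css.rowSpZ ∧ hammingNorm v = 18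

-- `WeightEighteenZLogical` holds: proved by `Summit.Ventures.QEC.Census.BB288.weightEighteenZLogical_proof` (its module imports this route file, so no `_holds` link can be stated here).

/-- item stmt-Ventures-19835 · support · rank 9 · closed · proved by Summit.Ventures.QEC.Theorems.TwelveLogicalQubits288_proof (prover) · by operator
sources: BravyiEtAl2024, arXiv:2308.07915, CalderbankShor1996
[support] DIMENSION — k(BB.bb288) = 288 − rk H^X − rk H^Z = 12 (rk H^X = rk H^Z = 138 over 𝔽₂), by a
rank certificate (type-02's Census/RankCert.lean p462257; BB288Rank staged by type-02 g2, chunked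
`RankCert.check`) transported with `BB.Code.cssFlat_k`; equivalently k = 2·dim(ker A ∩ ker B) (Lemma
1). [difficulty: provable-now] -/
@[route_item "route-Ventures-BB288DistanceCertificate"]
def TwelveLogicalQubits288 : Prop :=
  (Literature.InformationTheory.QuantumCodes.BB.bb288).k = 12

-- `TwelveLogicalQubits288` holds: proved by `Summit.Ventures.QEC.Theorems.TwelveLogicalQubits288_proof` (its module imports this route file, so no `_holds` link can be stated here).

/-- item stmt-Ventures-19836 · assembly · rank 1 · closed · proved by Summit.Ventures.QEC.Theorems.bb288DistanceCertificate_assembly_proof (prover) · by operator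
sources: BravyiEtAl2024
[assembly] NoZLogicalBelowEighteen → WeightEighteenZLogical → TwelveLogicalQubits288 → the
[[288,12,18]] claim. -/
@[route_item "route-Ventures-BB288DistanceCertificate"]
def Assembly : Prop :=
  NoZLogicalBelowEighteen → WeightEighteenZLogical → TwelveLogicalQubits288 → Summit.Ventures.QEC.BB.BB288_12_18_claim

-- `Assembly` holds: proved by `Summit.Ventures.QEC.Theorems.bb288DistanceCertificate_assembly_proof` (its module imports this route file, so no `_holds` link can be stated here).

/-! D-0027 §2.1 — DECIDING THEOREM (planner-authored via `route open/edit --closes-file`; by operator:999:2414619 2026-08-26T23:35:31Z):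
its hypotheses are this route's items and its conclusion the registered leaf `Summit.Ventures.QEC.BB.BB288_12_18_claim` (rung Q2, D-0061) (glue_lint), and it elaborates with this file. -/

/-- **Deciding theorem of route BB288DistanceCertificate** (Ventures/QEC rung Q2; D-0027 §2.1, D-0059/D-0061/D-0092:
closes_target = the registered CLAIM leaf `Summit.Ventures.QEC.BB.BB288_12_18_claim`, never a summit Statement).
Lower bound + explicit weight-d witness ⇒ d^Z(BB.bb288) = d (`CSSCode.dZ_eq_of_witness`); n by counting
(`numQubits_claims.2.2.2.2`); k (support item); then `hasParams_of_dZ` (Lemma 1 of Bravyi et al.: `d = d^Z`, tree theorem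
`BB.Code.d_eq_dZ`). Routed THROUGH `Assembly` and `Target` so both decls are in the cone of `closes`; every binder load-bearing;
fully qualified names, no `open`. -/
@[closes "route-Ventures-BB288DistanceCertificate"] theorem closes (hL : NoZLogicalBelowEighteen) (hU : WeightEighteenZLogical) (hK : TwelveLogicalQubits288) :
    Summit.Ventures.QEC.BB.BB288_12_18_claim := by
  have hA : Assembly := fun hL' hU' hK' => by
    obtain ⟨v, hv, hv', hwt⟩ := hU'
    exact Summit.Ventures.QEC.BB.hasParams_of_dZ Summit.Ventures.QEC.BB.numQubits_claims.2.2.2.2 hK'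
      ((Literature.InformationTheory.QuantumCodes.BB.bb288).css.dZ_eq_of_witness hv hv' hwt hL')
  have hT : Target := hA hL hU hK
  exact hT

end Summit.Ventures.QEC.Theses.BB288DistanceCertificate
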